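import Mathlib
import Summits.ValiantsHypothesis.ValiantsHypothesis.Theorems.FifoMatchingNNDivisionHardLongSpreadLaw
import Summits.ValiantsHypothesis.ValiantsHypothesis.Theorems.FifoMatchingNNDivisionHardShortLocalConditional
import Summits.ValiantsHypothesis.ValiantsHypothesis.Theorems.FifoMatchingNNDivisionHardCorSandwich
import Summits.ValiantsHypothesis.ValiantsHypothesis.Theses.FifoMatching
import HarnessLib

/-!
# Route FifoMatching — crux `NNDivisionHard` (stmt-ValiantsHypothesis-21181): SHORT-ARC-LOCAL COFACTORS ARE NOT CERTIFICATES
# (unconditional; the export asked for by `…ShortLocalConditional.lean` is discharged)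

A cofactor `h ∈ ℝ≥0[x]`, `h ≠ 0`, is SHORT-ARC-LOCAL at length `n` if every variable `x_(i,j)` of `h` has `(j − i)³ ≤ n²`
(arcs of length at most `n^{2/3}`; e.g. every cofactor all of whose variables are internal to aligned blocks of half-size
`b` with `8b³ ≤ n²` — in particular the block products `Π_t ι_t(NN_b)` with ALL blocks polylogarithmic, the conjectural test
member which passed every by-name tier of record, cf. the exit report of hand leafhand-4).  This file proves:

* `lt_add_of_cube_le` — a short arc is below every long threshold: `(j − i)³ ≤ n² < ℓ₀³ ⇒ j < i + ℓ₀`;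
* ★ `shortLocal_spreadLaw` — the LONG SPREAD LAW for the cost `L₊(NN_n · h) + 1` of a short-arc-local cofactor: for every
  long-supported spread measure (all arcs `≥ ℓ₀`, `n² < ℓ₀³`, `ℓ₀ ≤ n`), `1 ≤ 4 (L₊(NN_n·h) + 1) (n+1)² β`
  (`LocalCofactor.complexity_longFace_le_of_shortLocal` + `SupportBetween.one_le_complexity_mul_of_spread_of_support_between`
  — the two halves of `ShortLocalConditional.shortLocal_lower_bound_of_longSpreadMeasure`);
* ★★ `shortLocal_exp_lower_bound` — **`2^{n^{1/6}} ≤ L₊(NN_n · h) + 1` for every short-arc-local `h ≠ 0`, `n` large**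
  (the long-arc engine `LongSpreadLaw.exp_lower_bound_of_longSpreadLaw` on the least such cost);
* ★★ `shortLocal_not_certificate_qp` — **for every `c`, eventually in `n`, every short-arc-local `h ≠ 0` satisfies the crux
  inequality `2^((log₂ n + c)^c) < L₊(NN_n · h) + L₊(h)`**;
* ★ `blockLocal_not_certificate_qp` — instance: cofactors all of whose variables are internal to aligned blocks
  `[2ib, 2ib + 2b)` with `8b³ ≤ n²` (any number of blocks, any degree);
* ★ BY NAME `nnDivisionHard_iff_longReachingTier` — `NNDivisionHard` ⟺ the same inequality for the cofactors having at
  least one variable `x_(i,j)` with `(j − i)³ > n²` (a LONG-REACHING arc).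

HONEST FRAMING: one more tier of the residual programme of stmt-21181 decided (the short-arc-local one, including the
all-small-blocks product test member); stmt-21181 stays OPEN (its residual is now: grand residual ∧ block-dense ∧
prefix-non-generic ∧ adjacent-non-generic ∧ LONG-REACHING); nothing here bears on `NNNotVP` or on VP ≠ VNP (NOT proved).
No definitions, no named facts.
References: Hrubeš–Yehudayoff 2021 §6 Problem 2 [HrubesYehudayoff2021]; Bürgisser 2000 Rem. 2.7 [Burgisser2000];
Jerrum–Snir 1982 [JerrumSnir1982].
-/

noncomputable section

-- Sub = Summit single-conjunct layout: the duplicated namespace component is mandated by the tree.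
set_option linter.dupNamespace false
set_option autoImplicit false

namespace Summit.ValiantsHypothesis.ValiantsHypothesis.Theorems.FifoMatching.NNDivisionHard.ShortLocal

open Finset MvPolynomial Literature.Computability.AlgebraicComplexity
open Summit.ValiantsHypothesis.ValiantsHypothesis.Theorems.FifoMatching.NNDivisionHard.LongSpreadLaw
  (exp_lower_bound_of_longSpreadLaw)
open Summit.ValiantsHypothesis.ValiantsHypothesis.Theorems.FifoMatching.NNDivisionHard.LocalCofactor
  (complexity_longFace_le_of_shortLocal)
open Summit.ValiantsHypothesis.ValiantsHypothesis.Theorems.FifoMatching.NNDivisionHard.SupportBetween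
  (one_le_complexity_mul_of_spread_of_support_between)
open Summit.ValiantsHypothesis.ValiantsHypothesis.Theorems.FifoMatching.NNDivisionHard.ShortLocalConditional
  (support_longFace_subset arcExponent_mem_support_longFace)
open scoped NNReal BigOperators

variable {n : ℕ}

/-! ### §1 Short arcs versus long thresholds -/

/-- A short arc lies below every long threshold: `(j − i)³ ≤ n² < ℓ₀³` gives `j < i + ℓ₀`. [folklore] -/
theorem lt_add_of_cube_le {i j ℓ₀ n : ℕ} (h : (j - i) ^ 3 ≤ n ^ 2) (hℓ : n ^ 2 < ℓ₀ ^ 3) : j < i + ℓ₀ := by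
  have h1 : (j - i) ^ 3 < ℓ₀ ^ 3 := lt_of_le_of_lt h hℓ
  have h2 : j - i < ℓ₀ := (Nat.pow_lt_pow_iff_left (by norm_num)).1 h1
  omega

/-- Exponent bookkeeping: `(ℓ + c)^c + 2 ≤ (ℓ + c + 2)^(c + 2)` for `ℓ ≥ 1`. [folklore] -/
theorem polylog_add_two_le (ℓ c : ℕ) (hℓ : 1 ≤ ℓ) : (ℓ + c) ^ c + 2 ≤ (ℓ + c + 2) ^ (c + 2) := by
  have hE : 1 ≤ (ℓ + c) ^ c := Nat.one_le_pow _ _ (by omega)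
  have h1 : (ℓ + c) ^ c ≤ (ℓ + c + 2) ^ c := Nat.pow_le_pow_left (by omega) c
  calc (ℓ + c) ^ c + 2 ≤ (ℓ + c) ^ c * 3 := by omega
    _ ≤ (ℓ + c + 2) ^ c * (ℓ + c + 2) := Nat.mul_le_mul h1 (by omega)
    _ = (ℓ + c + 2) ^ (c + 1) := (pow_succ _ _).symm
    _ ≤ (ℓ + c + 2) ^ (c + 2) := Nat.pow_le_pow_right (by omega) (by omega)

/-! ### §2 The long spread law for short-arc-local cofactors -/

/-- ★ **The LONG SPREAD LAW for short-arc-local cofactors.**  Let `n ≥ 3`, `ℓ₀ ≤ n` with `n² < ℓ₀³`, and let `μ` be a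
probability weighting of the nest-free perfect matchings of `[2n]` supported on matchings all of whose arcs have length `≥ ℓ₀`
and respecting every balanced split with mass `≤ β`.  Then every `h ≠ 0` all of whose variables `x_(i,j)` have
`(j − i)³ ≤ n²` satisfies `1 ≤ 4 · (L₊(NN_n · h) + 1) · (n+1)² · β`. [cite: HrubesYehudayoff2021, §6 Problem 2]
[cite: Burgisser2000, Rem. 2.7] -/
theorem shortLocal_spreadLaw (hn : 3 ≤ n) {ℓ₀ : ℕ} (hℓ3 : n ^ 2 < ℓ₀ ^ 3) (hℓn : ℓ₀ ≤ n) {β : ℝ≥0}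
    (μ : (Fin (2 * n) → Fin (2 * n)) → ℝ≥0) (hμ : ∑ M ∈ nestFreeMatchings (2 * n), μ M = 1)
    (hμlong : ∀ M ∈ nestFreeMatchings (2 * n), μ M ≠ 0 → ∀ i ∈ openers M, (i : ℕ) + ℓ₀ ≤ (M i : ℕ))
    (hβ : ∀ S : Finset (Fin (2 * n)), 2 * n < 3 * S.card → 3 * S.card ≤ 4 * n →
      (∑ M ∈ (nestFreeMatchings (2 * n)).filter (fun M => ∀ i, i ∈ S ↔ M i ∈ S), μ M) ≤ β)
    {h : MvPolynomial (Fin (2 * n) × Fin (2 * n)) ℝ≥0} (hh : h ≠ 0)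
    (hshort : ∀ e ∈ h.vars, ((e.2 : ℕ) - (e.1 : ℕ)) ^ 3 ≤ n ^ 2) :
    (1 : ℝ) ≤ 4 * ((complexity (nestFreeMatchingPoly n ℝ≥0 * h) + 1 : ℕ) : ℝ) * ((n : ℝ) + 1) ^ 2 * (β : ℝ) := by
  have hshort' : ∀ e ∈ h.vars, (e.2 : ℕ) < (e.1 : ℕ) + ℓ₀ :=
    fun e he => lt_add_of_cube_le (hshort e he) hℓ3
  have hred := complexity_longFace_le_of_shortLocal hℓn hh hshort'
  have hone := one_le_complexity_mul_of_spread_of_support_between hn (support_longFace_subset ℓ₀) μ hμ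
    (fun M hM hμM => arcExponent_mem_support_longFace ℓ₀ hM (hμlong M hM hμM)) hβ
  set F := complexity (∑ M ∈ (nestFreeMatchings (2 * n)).filter (fun M => ∀ i ∈ openers M,
        (i, M i) ∉ (univ : Finset (Fin (2 * n) × Fin (2 * n))).filter (fun e => (e.2 : ℕ) < (e.1 : ℕ) + ℓ₀)),
        arcMonomial ℝ≥0 M) with hF
  have hle : (F : ℝ) ≤ ((complexity (nestFreeMatchingPoly n ℝ≥0 * h) + 1 : ℕ) : ℝ) := by
    exact_mod_cast hred
  calc (1 : ℝ) ≤ 4 * (F : ℝ) * ((n : ℝ) + 1) ^ 2 * (β : ℝ) := hone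
    _ ≤ 4 * ((complexity (nestFreeMatchingPoly n ℝ≥0 * h) + 1 : ℕ) : ℝ) * ((n : ℝ) + 1) ^ 2 * (β : ℝ) := by
        gcongr

/-! ### §3 The stretched-exponential bound and the crux inequality -/

/-- ★★ **`2^{n^{1/6}} ≤ L₊(NN_n · h) + 1` for every SHORT-ARC-LOCAL cofactor `h ≠ 0`** (all variables `x_(i,j)` with
`(j − i)³ ≤ n²`), for all large `n`: the long-arc thick-queue engine applied to the least such cost.
[cite: HrubesYehudayoff2021, §6 Problem 2] -/
theorem shortLocal_exp_lower_bound : ∃ n₀ : ℕ, ∀ n : ℕ, n₀ ≤ n →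
    ∀ h : MvPolynomial (Fin (2 * n) × Fin (2 * n)) ℝ≥0, h ≠ 0 →
      (∀ e ∈ h.vars, ((e.2 : ℕ) - (e.1 : ℕ)) ^ 3 ≤ n ^ 2) →
      (2 : ℝ) ^ ((n : ℝ) ^ ((1 : ℝ) / 6)) ≤ ((complexity (nestFreeMatchingPoly n ℝ≥0 * h) + 1 : ℕ) : ℝ) := by
  classical
  -- the class of short-arc-local cofactors and its least cost
  let good : (n : ℕ) → Set ℕ := fun n => {L | ∃ h : MvPolynomial (Fin (2 * n) × Fin (2 * n)) ℝ≥0,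
    h ≠ 0 ∧ (∀ e ∈ h.vars, ((e.2 : ℕ) - (e.1 : ℕ)) ^ 3 ≤ n ^ 2) ∧
      L = complexity (nestFreeMatchingPoly n ℝ≥0 * h) + 1}
  have hone : ∀ n, complexity (nestFreeMatchingPoly n ℝ≥0 * 1) + 1 ∈ good n := fun n =>
    ⟨1, one_ne_zero, fun e he => by simp [vars_one] at he, rfl⟩
  set F : ℕ → ℕ := fun n => sInf (good n) with hF
  have hmem : ∀ n, F n ∈ good n := fun n => Nat.sInf_mem ⟨_, hone n⟩
  obtain ⟨n₀, hn₀⟩ := exp_lower_bound_of_longSpreadLaw F (fun n hn ℓ₀ hℓ3 hℓn β μ hμ hμlong hS => by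
    obtain ⟨h, hh, hsh, hL⟩ := hmem n
    rw [hL]
    exact shortLocal_spreadLaw hn hℓ3 hℓn μ hμ hμlong hS hh hsh)
  refine ⟨n₀, fun n hn h hh hsh => ?_⟩
  have hle : F n ≤ complexity (nestFreeMatchingPoly n ℝ≥0 * h) + 1 := Nat.sInf_le ⟨h, hh, hsh, rfl⟩
  exact (hn₀ n hn).trans (by exact_mod_cast hle)

/-- ★★ **SHORT-ARC-LOCAL COFACTORS ARE NOT CERTIFICATES (currency of stmt-21181).**  For every `c`, eventually in `n`:
every cofactor `h ≠ 0` all of whose variables `x_(i,j)` have `(j − i)³ ≤ n²` satisfies the crux inequality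
`2^((log₂ n + c)^c) < L₊(NN_n · h) + L₊(h)`. [cite: HrubesYehudayoff2021, §6 Problem 2] [cite: Burgisser2000, Rem. 2.7] -/
theorem shortLocal_not_certificate_qp (c : ℕ) : ∃ n₀ : ℕ, ∀ n : ℕ, n₀ ≤ n →
    ∀ h : MvPolynomial (Fin (2 * n) × Fin (2 * n)) ℝ≥0, h ≠ 0 →
      (∀ e ∈ h.vars, ((e.2 : ℕ) - (e.1 : ℕ)) ^ 3 ≤ n ^ 2) →
      2 ^ ((Nat.log 2 n + c) ^ c) < complexity (nestFreeMatchingPoly n ℝ≥0 * h) + complexity h := by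
  obtain ⟨n₁, hn₁⟩ := shortLocal_exp_lower_bound
  obtain ⟨n₂, hn₂⟩ := CorSandwich.polylog_lt_rpow_eventually (c + 2) (c := 1 / 6) (by norm_num)
  refine ⟨max (max n₁ n₂) 2, fun n hn h hh hsh => ?_⟩
  have hn1 : n₁ ≤ n := le_trans (le_trans (le_max_left _ _) (le_max_left _ _)) hn
  have hn2 : n₂ ≤ n := le_trans (le_trans (le_max_right _ _) (le_max_left _ _)) hn
  have h2n : 2 ≤ n := le_trans (le_max_right _ _) hn
  have h1 := hn₁ n hn1 h hh hsh
  have h2 := hn₂ n hn2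
  have h3 : (2 : ℝ) ^ ((((Nat.log 2 n + (c + 2)) ^ (c + 2) : ℕ) : ℝ)) < (2 : ℝ) ^ ((n : ℝ) ^ ((1 : ℝ) / 6)) :=
    Real.rpow_lt_rpow_of_exponent_lt (by norm_num) h2
  have h4 : ((2 ^ ((Nat.log 2 n + (c + 2)) ^ (c + 2)) : ℕ) : ℝ) <
      ((complexity (nestFreeMatchingPoly n ℝ≥0 * h) + 1 : ℕ) : ℝ) := by
    rw [Nat.cast_pow, Nat.cast_ofNat, ← Real.rpow_natCast]
    exact h3.trans_le h1
  have h5 : 2 ^ ((Nat.log 2 n + (c + 2)) ^ (c + 2)) < complexity (nestFreeMatchingPoly n ℝ≥0 * h) + 1 := by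
    exact_mod_cast h4
  have hlog : 1 ≤ Nat.log 2 n := Nat.le_log_of_pow_le one_lt_two (by simpa using h2n)
  have hE := polylog_add_two_le (Nat.log 2 n) c hlog
  have hE' : (Nat.log 2 n + c) ^ c + 2 ≤ (Nat.log 2 n + (c + 2)) ^ (c + 2) := by
    rw [show Nat.log 2 n + (c + 2) = Nat.log 2 n + c + 2 by ring]; exact hE
  have hpow : 2 ^ ((Nat.log 2 n + c) ^ c + 2) ≤ 2 ^ ((Nat.log 2 n + (c + 2)) ^ (c + 2)) :=
    Nat.pow_le_pow_right Nat.two_pos hE'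
  have h4' : 2 ^ ((Nat.log 2 n + c) ^ c + 2) = 4 * 2 ^ ((Nat.log 2 n + c) ^ c) := by ring
  have hk : 1 ≤ 2 ^ ((Nat.log 2 n + c) ^ c) := Nat.one_le_two_pow
  omega

/-- ★ **Instance: BLOCK-LOCAL cofactors with small blocks.**  For every `c`, eventually in `n`: if `8b³ ≤ n²` and every
variable `x_(i,j)` of `h ≠ 0` is internal to some aligned block `[2tb, 2tb + 2b)` (any number of blocks, any degree — e.g.
products `Π_t ι_t(g_t)` of polynomials placed in distinct blocks of half-size `b`), then
`2^((log₂ n + c)^c) < L₊(NN_n · h) + L₊(h)`. [cite: HrubesYehudayoff2021, §6 Problem 2] -/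
theorem blockLocal_not_certificate_qp (c : ℕ) : ∃ n₀ : ℕ, ∀ n : ℕ, n₀ ≤ n → ∀ b : ℕ, 8 * b ^ 3 ≤ n ^ 2 →
    ∀ h : MvPolynomial (Fin (2 * n) × Fin (2 * n)) ℝ≥0, h ≠ 0 →
      (∀ e ∈ h.vars, ∃ t : ℕ, 2 * t * b ≤ (e.1 : ℕ) ∧ (e.1 : ℕ) < 2 * t * b + 2 * b ∧
        2 * t * b ≤ (e.2 : ℕ) ∧ (e.2 : ℕ) < 2 * t * b + 2 * b) →
      2 ^ ((Nat.log 2 n + c) ^ c) < complexity (nestFreeMatchingPoly n ℝ≥0 * h) + complexity h := by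
  obtain ⟨n₀, hn₀⟩ := shortLocal_not_certificate_qp c
  refine ⟨n₀, fun n hn b hb h hh hloc => hn₀ n hn h hh fun e he => ?_⟩
  obtain ⟨t, h1, h2, h3, h4⟩ := hloc e he
  have hd : (e.2 : ℕ) - (e.1 : ℕ) ≤ 2 * b := by omega
  calc ((e.2 : ℕ) - (e.1 : ℕ)) ^ 3 ≤ (2 * b) ^ 3 := Nat.pow_le_pow_left hd 3
    _ = 8 * b ^ 3 := by ring
    _ ≤ n ^ 2 := hb

/-! ### §4 By name -/

/-- ★ **BY NAME: `NNDivisionHard` ⟺ its LONG-REACHING tier.**  The crux (stmt-ValiantsHypothesis-21181) is equivalent to the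
same inequality for the cofactors having at least one variable `x_(i,j)` with `n² < (j − i)³` (an arc longer than `n^{2/3}`);
the short-arc-local cofactors are settled by `shortLocal_not_certificate_qp`. [cite: HrubesYehudayoff2021, §6 Problem 2] -/
theorem nnDivisionHard_iff_longReachingTier :
    Summit.ValiantsHypothesis.ValiantsHypothesis.Theses.FifoMatching.NNDivisionHard ↔
    ∀ c : ℕ, ∃ n₀ : ℕ, ∀ n ≥ n₀, ∀ h : MvPolynomial (Fin (2 * n) × Fin (2 * n)) ℝ≥0, h ≠ 0 →
      (∃ e ∈ h.vars, n ^ 2 < ((e.2 : ℕ) - (e.1 : ℕ)) ^ 3) →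
      2 ^ ((Nat.log 2 n + c) ^ c) < complexity (nestFreeMatchingPoly n ℝ≥0 * h) + complexity h := by
  constructor
  · intro hN c
    obtain ⟨n₀, hn₀⟩ := hN c
    exact ⟨n₀, fun n hn h hh _ => hn₀ n hn h hh⟩
  · intro H c
    obtain ⟨n₀, hn₀⟩ := H c
    obtain ⟨n₁, hn₁⟩ := shortLocal_not_certificate_qp c
    refine ⟨max n₀ n₁, fun n hn h hh => ?_⟩
    by_cases hlong : ∃ e ∈ h.vars, n ^ 2 < ((e.2 : ℕ) - (e.1 : ℕ)) ^ 3
    · exact hn₀ n (le_trans (le_max_left _ _) hn) h hh hlong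
    · push Not at hlong
      exact hn₁ n (le_trans (le_max_right _ _) hn) h hh hlong

end Summit.ValiantsHypothesis.ValiantsHypothesis.Theorems.FifoMatching.NNDivisionHard.ShortLocal

end
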